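import Summits.KontsevichZagierPeriods.KontsevichZagierPeriods.Theses.AbelContraction
import Summits.KontsevichZagierPeriods.KontsevichZagierPeriods.Theses.SymplecticScissors
import Summits.KontsevichZagierPeriods.KontsevichZagierPeriods.Theorems.AbelContractionRealArcKernelSolidVolumes

/-!
# KontsevichZagierPeriods / AbelContraction — crux `RealArcKernel` (stmt-KontsevichZagierPeriods-12472),
# line `dimtwo_redirect`: the open stub `stub_solidVolumes` IS the dimension-`3` layer of the volume
# conjecture (route SymplecticScissors' frame), and that layer already decides the plane
# (support file, lands `--supports`)

The reshaped line has two open stubs, `stub_solidVolumes` (`SolidVolumes₃`: equal-volume BOUNDED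
volume representations of dimension `3` are KZ-equivalent) and `stub_reductionToDimensionTwo`
(stmt-18030). This file identifies the first with statements other routes already carry:

* `solidVolumes_iff_volumeForm_three` — `SolidVolumes₃ ↔ VolumeForm₃`, the dimension-`3` instance of
  route SymplecticScissors' frame `VolumeForm` (stmt-3814) / `VolumeFormOffPlane` (stmt-14935): finite
  volume suffices, boundedness is free (`KZ.exists_isBounded_sub_mem_relations`: grounding + monomial
  compression, the tree's resolution-free substitute for Viu-Sos' Cor. 2.2);
* `solidVolumes_of_volumeFormOffPlane : SymplecticScissors.VolumeFormOffPlane → SolidVolumes₃`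
  (registered sub-goal of stmt-12472), hence `kzDimTwo_of_volumeFormOffPlane`,
  `realArcKernel_of_volumeFormOffPlane` (with `ReductionToDimensionTwo`): the crux of THIS route from
  SymplecticScissors' crux stmt-14935 and stmt-18030;
* `volumeForm_of_succ` — the layers of the volume conjecture are MONOTONE: layer `N + 1` implies layer
  `N` (one unit slab, a single Newton–Leibniz move, `KZ.IntegralRep.equivalent_slab`); in particular
  `planarAreas_of_volumeForm_three : VolumeForm₃ → PlanarAreas`. (That the off-plane frame already
  contains the plane, `VolumeFormOffPlane → VolumeForm`, is in the tree:
  `LiouvilleUnfolding.NilradicalCut.volumeForm_of_volumeFormOffPlane`,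
  `volumeFormOffPlane_iff_volumeForm`, Theorems/LiouvilleUnfoldingAyoubPiLocalKernelRungOne.lean; the
  graded principle "Conjecture 1 in dimensions `≤ d` ⟺ volume conjecture for compact bodies of `ℝ^{d+1}`"
  is `NilradicalCut.kzKernel_dim_le_iff_volumeConjecture_succ`,
  Theorems/LiouvilleUnfoldingAyoubPiLocalKernelDimensionLadder.lean.)

Sources: M. Kontsevich, D. Zagier, *Periods* (2001), §1.2; J. Cresson, J. Viu-Sos (2022), §1
(volume form of Conjecture 1); J. Viu-Sos (2021), Thm. 1.1 / Cor. 2.2–2.3.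
Deliberately NOT here: any attack on `VolumeForm₃` / `SolidVolumes₃` or on `ReductionToDimensionTwo`.
-/

noncomputable section

open Literature.NumberTheory.Transcendental
open Summit.KontsevichZagierPeriods.KontsevichZagierPeriods.Theses.AbelContraction
  (RealArcKernel PlanarAreas KZDimTwo ReductionToDimensionTwo)
open Summit.KontsevichZagierPeriods.KontsevichZagierPeriods.Theses.SymplecticScissors
  (VolumeForm VolumeFormOffPlane)

namespace Summit.KontsevichZagierPeriods.AbelContraction.RealArcKernelVolumeFormThree

/-! ## The layers of the volume conjecture are monotone -/

/-- **Layer `N + 1` of the volume conjecture implies layer `N`.** If every two integrand-`1`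
representations of dimension `N + 1` with equal volumes are KZ-equivalent, then so are every two
integrand-`1` representations of dimension `N`: replace each by its unit slab `σ × [0, 1]` (one
Newton–Leibniz move, `KZ.IntegralRep.equivalent_slab`; same volume by soundness; integrand still `1`).
[cite: KontsevichZagier2001, §1.2 rule (3)] -/
theorem volumeForm_of_succ {N : ℕ}
    (h : ∀ (s s' : KZ.IntegralRep (N + 1)), (∀ x ∈ s.domain, s.integrand x = 1) →
      (∀ x ∈ s'.domain, s'.integrand x = 1) → s.value = s'.value → KZ.Equivalent s s')
    (r r' : KZ.IntegralRep N) (hr : ∀ x ∈ r.domain, r.integrand x = 1)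
    (hr' : ∀ x ∈ r'.domain, r'.integrand x = 1) (hv : r.value = r'.value) : KZ.Equivalent r r' := by
  have e : KZ.Equivalent r (r.slab 0) := r.equivalent_slab 0
  have e' : KZ.Equivalent r' (r'.slab 0) := r'.equivalent_slab 0
  have hv' : (r.slab 0).value = (r'.slab 0).value := by
    rw [← KZ.Equivalent.value_eq_holds e, ← KZ.Equivalent.value_eq_holds e', hv]
  exact (e.trans (h _ _ (r.slab_integrand_eq_one 0 hr) (r'.slab_integrand_eq_one 0 hr') hv')).trans
    e'.symm

/-- **Layer `N + e` implies layer `N`** (iterate `volumeForm_of_succ`). [cite: KontsevichZagier2001, §1.2 rule (3)] -/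
theorem volumeForm_of_add {N : ℕ} : ∀ (e : ℕ),
    (∀ (s s' : KZ.IntegralRep (N + e)), (∀ x ∈ s.domain, s.integrand x = 1) →
      (∀ x ∈ s'.domain, s'.integrand x = 1) → s.value = s'.value → KZ.Equivalent s s') →
    ∀ (r r' : KZ.IntegralRep N), (∀ x ∈ r.domain, r.integrand x = 1) →
      (∀ x ∈ r'.domain, r'.integrand x = 1) → r.value = r'.value → KZ.Equivalent r r'
  | 0, h => h
  | e + 1, h => volumeForm_of_add e (volumeForm_of_succ h)

/-- **The dimension-`3` layer already gives the plane**: `VolumeForm₃ → PlanarAreas` (stmt-4990 is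
`VolumeForm` in dimension `2`, one slab below). [cite: KontsevichZagier2001, §1.2 rule (3)] -/
theorem planarAreas_of_volumeForm_three
    (h : ∀ (s s' : KZ.IntegralRep 3), (∀ x ∈ s.domain, s.integrand x = 1) →
      (∀ x ∈ s'.domain, s'.integrand x = 1) → s.value = s'.value → KZ.Equivalent s s') :
    PlanarAreas :=
  fun r r' hr hr' hv => volumeForm_of_succ h r r' hr hr' hv

/-! ## `SolidVolumes₃` is `VolumeForm₃` -/

/-- `VolumeForm₃ → SolidVolumes₃` (drop boundedness). [cite: CressonViusos2022, §1 p. 326] -/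
theorem solidVolumes_of_volumeForm_three
    (h : ∀ (s s' : KZ.IntegralRep 3), (∀ x ∈ s.domain, s.integrand x = 1) →
      (∀ x ∈ s'.domain, s'.integrand x = 1) → s.value = s'.value → KZ.Equivalent s s') :
    ∀ (u v : KZ.IntegralRep 3), (Bornology.IsBounded u.domain ∧ ∀ z ∈ u.domain, u.integrand z = 1) →
      (Bornology.IsBounded v.domain ∧ ∀ z ∈ v.domain, v.integrand z = 1) → u.value = v.value →
      KZ.Equivalent u v :=
  fun u v hu hv huv => h u v hu.2 hv.2 huv

/-- **`SolidVolumes₃ → VolumeForm₃`**: boundedness is free — a finite-volume integrand-`1`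
representation of dimension `3 = 2 + 1` differs by relations from a BOUNDED one
(`KZ.exists_isBounded_sub_mem_relations`: grounding of the coordinates and monomial compression), with
the same volume by soundness. [cite: ViuSos2021, Thm. 1.1 (Cor. 2.2 replaced)] -/
theorem volumeForm_three_of_solidVolumes
    (h3 : ∀ (u v : KZ.IntegralRep 3), (Bornology.IsBounded u.domain ∧ ∀ z ∈ u.domain, u.integrand z = 1) →
      (Bornology.IsBounded v.domain ∧ ∀ z ∈ v.domain, v.integrand z = 1) → u.value = v.value →
      KZ.Equivalent u v) :
    ∀ (s s' : KZ.IntegralRep 3), (∀ x ∈ s.domain, s.integrand x = 1) →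
      (∀ x ∈ s'.domain, s'.integrand x = 1) → s.value = s'.value → KZ.Equivalent s s' := by
  intro s s' hs hs' hv
  obtain ⟨B, hBb, hB1, eB⟩ := KZ.exists_isBounded_sub_mem_relations (m := 2) s hs
  obtain ⟨B', hB'b, hB'1, eB'⟩ := KZ.exists_isBounded_sub_mem_relations (m := 2) s' hs'
  have hvB : B.value = B'.value := by
    rw [← KZ.Equivalent.value_eq_holds eB, ← KZ.Equivalent.value_eq_holds eB', hv]
  have hBB' : KZ.Equivalent B B' := h3 B B' ⟨hBb, hB1⟩ ⟨hB'b, hB'1⟩ hvB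
  exact (KZ.Equivalent.trans eB hBB').trans (KZ.Equivalent.symm eB')

/-- **`SolidVolumes₃ ↔ VolumeForm₃`**: the open stub of line `dimtwo_redirect` is exactly the
dimension-`3` layer of the volume conjecture (the frame of route SymplecticScissors at `N = 3`).
[cite: CressonViusos2022, §1 p. 326] -/
theorem solidVolumes_iff_volumeForm_three :
    (∀ (u v : KZ.IntegralRep 3), (Bornology.IsBounded u.domain ∧ ∀ z ∈ u.domain, u.integrand z = 1) →
      (Bornology.IsBounded v.domain ∧ ∀ z ∈ v.domain, v.integrand z = 1) → u.value = v.value →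
      KZ.Equivalent u v) ↔
    ∀ (s s' : KZ.IntegralRep 3), (∀ x ∈ s.domain, s.integrand x = 1) →
      (∀ x ∈ s'.domain, s'.integrand x = 1) → s.value = s'.value → KZ.Equivalent s s' :=
  ⟨volumeForm_three_of_solidVolumes, solidVolumes_of_volumeForm_three⟩

/-- **`VolumeFormOffPlane → SolidVolumes₃`** (registered sub-goal `solidVolumes_of_volumeFormOffPlane` of
stmt-12472): the open stub of this route's line follows from route SymplecticScissors' crux stmt-14935
at `N = 3`. [cite: CressonViusos2022, §1 p. 326] -/
theorem solidVolumes_of_volumeFormOffPlane : Summit.KontsevichZagierPeriods.KontsevichZagierPeriods.Theses.SymplecticScissors.VolumeFormOffPlane → ∀ (u v : KZ.IntegralRep 3), (Bornology.IsBounded u.domain ∧ ∀ z ∈ u.domain, u.integrand z = 1) → (Bornology.IsBounded v.domain ∧ ∀ z ∈ v.domain, v.integrand z = 1) → u.value = v.value → KZ.Equivalent u v :=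
  fun h => solidVolumes_of_volumeForm_three (h (by decide))

/-! ## Consequences for the crux -/

/-- `VolumeFormOffPlane → KZDimTwo`: SymplecticScissors' off-plane frame decides Conjecture 1 on the
dimension-two stratum (stmt-4280), through `kzDimTwo_of_solidVolumes`.
[cite: KontsevichZagier2001, §1.2 Conjecture 1] -/
theorem kzDimTwo_of_volumeFormOffPlane (h : VolumeFormOffPlane) : KZDimTwo :=
  Summit.KontsevichZagierPeriods.AbelContraction.RealArcKernelSolidVolumes.kzDimTwo_of_solidVolumes
    (solidVolumes_of_volumeFormOffPlane h)

/-- **The crux from two cruxes of two routes**: `VolumeFormOffPlane → ReductionToDimensionTwo →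
RealArcKernel` (SymplecticScissors stmt-14935 ∧ AbelContraction stmt-18030 ⟹ AbelContraction
stmt-12472). [cite: KontsevichZagier2001, §1.2 Conjecture 1] -/
theorem realArcKernel_of_volumeFormOffPlane (h : VolumeFormOffPlane) (hRed : ReductionToDimensionTwo) :
    RealArcKernel :=
  Summit.KontsevichZagierPeriods.AbelContraction.RealArcKernelSolidVolumes.realArcKernel_of_solidVolumes
    (solidVolumes_of_volumeFormOffPlane h) hRed

/-- … and the summit: `VolumeFormOffPlane → ReductionToDimensionTwo → KontsevichZagierPeriods`.
[cite: KontsevichZagier2001, §1.2 Conjecture 1] -/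
theorem kontsevichZagierPeriods_of_volumeFormOffPlane (h : VolumeFormOffPlane)
    (hRed : ReductionToDimensionTwo) : KontsevichZagierPeriods :=
  Summit.KontsevichZagierPeriods.AbelContraction.RealArcKernelSolidVolumes.kontsevichZagierPeriods_of_solidVolumes
    (solidVolumes_of_volumeFormOffPlane h) hRed

end Summit.KontsevichZagierPeriods.AbelContraction.RealArcKernelVolumeFormThree

end
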